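import Summits.AtomisticToContinuum.BoseEinsteinCondensation.Theses.BECInsertionCorrector
import Literature.MathematicalPhysics.QuantumManyBody.LiebYngvasonBoxBound

/-!
# Negative lemmas for crux `CorrectorClosure` (stmt-AtomisticToContinuum-12058): load-bearing
hypotheses of the target `InsertionResidue`

Supports (does not close) stmt-AtomisticToContinuum-12058, route `BECInsertionCorrector`.

* `not_correctorClosure_iff` : `¬ CorrectorClosure ↔ StaticResponseBound ∧ ¬ InsertionResidue`.
* `planeWave N L k` : the boosted condensate `L^{-3N/2} ∏ⱼ exp(2πi k·xⱼ/L)` is an admissible periodic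
  trial state; for `k ≠ 0` its tagged zero-mode integral `∫_cell Ψ(x,X)dx` vanishes for every `X`
  (`setIntegral_cell_planeWave_succ`), so its insertion overlap with `φ₀ ⊗ Θ` is `0` for every `Θ`.
* `insertionResidue_false_without_window` : the target with the near-minimiser hypothesis on `Ψ`
  dropped is FALSE (any admissible `v`); `correctorClosureWithoutWindow_iff : (K1 → windowless
  target) ↔ ¬ K1`.
* `insertionResidue_false_without_finiteRange` : the target with `IsRepulsiveFiniteRange v` weakened
  to `Measurable v` is FALSE (`v ≡ 1`: `v^{per} = ⊤`, `E₀^{per}(N+1) = ⊤`, every state is a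
  near-minimiser).
-/

noncomputable section

open MeasureTheory Filter Metric WithLp
open scoped ENNReal NNReal ComplexConjugate BigOperators

namespace Summit.AtomisticToContinuum.BoseEinsteinCondensation.Theorems.CorrectorClosure.Negative

open Literature.MathematicalPhysics.QuantumManyBody.BoseGas
open Summit.AtomisticToContinuum.BoseEinsteinCondensation.Theses.BECInsertionCorrector

/-! ## §1 Logical shape of the crux -/

/-- `¬ CorrectorClosure` is literally `StaticResponseBound ∧ ¬ InsertionResidue`. [folklore] -/
theorem not_correctorClosure_iff :
    ¬ CorrectorClosure ↔ (StaticResponseBound ∧ ¬ InsertionResidue) := by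
  unfold CorrectorClosure
  constructor
  · intro h
    by_cases hS : StaticResponseBound
    · exact ⟨hS, fun hI => h fun _ => hI⟩
    · exact (h fun hS' => (hS hS').elim).elim
  · rintro ⟨hS, hI⟩ h
    exact hI (h hS)

/-- The target alone closes the crux. [folklore] -/
theorem correctorClosure_of_insertionResidue (h : InsertionResidue) : CorrectorClosure :=
  fun _ => h

/-- A refutation of K1 (`StaticResponseBound`) closes the crux vacuously. [folklore] -/
theorem correctorClosure_of_not_staticResponseBound (h : ¬ StaticResponseBound) :
    CorrectorClosure :=
  fun hS => (h hS).elim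

/-! ## §2 Plane-wave (boosted condensate) periodic trial states -/

/-- The phase `θ_k(x) = (2π/L) k·x`. [folklore] -/
def phase (L : ℝ) (k : Fin 3 → ℤ) (x : Space) : ℝ :=
  2 * Real.pi / L * ∑ c, (k c : ℝ) * x c

/-- The plane wave `e_k(x) = exp(i θ_k(x))` on the torus of side `L`. [folklore] -/
def pw (L : ℝ) (k : Fin 3 → ℤ) (x : Space) : ℂ :=
  Complex.exp (phase L k x * Complex.I)

/-- `|e_k(x)| = 1`. [folklore] -/
theorem norm_pw (L : ℝ) (k : Fin 3 → ℤ) (x : Space) : ‖pw L k x‖ = 1 := by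
  unfold pw
  exact Complex.norm_exp_ofReal_mul_I _

/-- `θ_k` is additive. [folklore] -/
theorem phase_add (L : ℝ) (k : Fin 3 → ℤ) (x y : Space) :
    phase L k (x + y) = phase L k x + phase L k y := by
  unfold phase
  rw [← mul_add, ← Finset.sum_add_distrib]
  congr 1
  refine Finset.sum_congr rfl fun c _ => ?_
  rw [PiLp.add_apply, mul_add]

/-- `θ_k(0) = 0`. [folklore] -/
theorem phase_zero (L : ℝ) (k : Fin 3 → ℤ) : phase L k 0 = 0 := by
  simp [phase]

/-- `θ_k(L e_c) = 2π k_c`. [folklore] -/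
theorem phase_single (L : ℝ) (hL : L ≠ 0) (k : Fin 3 → ℤ) (c : Fin 3) :
    phase L k (EuclideanSpace.single c L) = 2 * Real.pi * k c := by
  unfold phase
  have : ∑ c', (k c' : ℝ) * (EuclideanSpace.single c L : Space) c' = (k c : ℝ) * L := by
    rw [Finset.sum_eq_single c]
    · simp
    · intro b _ hb
      simp [hb]
    · intro h; exact (h (Finset.mem_univ c)).elim
  rw [this]
  field_simp

/-- `e_k(x+y) = e_k(x) e_k(y)`. [folklore] -/
theorem pw_add (L : ℝ) (k : Fin 3 → ℤ) (x y : Space) :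
    pw L k (x + y) = pw L k x * pw L k y := by
  unfold pw
  rw [phase_add, Complex.ofReal_add, add_mul, Complex.exp_add]

/-- `e_k` is `Lℤ³`-periodic on generators: `e_k(L e_c) = 1`. [folklore] -/
theorem pw_single (L : ℝ) (hL : L ≠ 0) (k : Fin 3 → ℤ) (c : Fin 3) :
    pw L k (EuclideanSpace.single c L) = 1 := by
  unfold pw
  rw [phase_single L hL k c]
  have : ((2 * Real.pi * (k c : ℝ) : ℝ) : ℂ) * Complex.I = (k c : ℤ) * (2 * Real.pi * Complex.I) := by
    push_cast; ring
  rw [this]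
  exact Complex.exp_int_mul_two_pi_mul_I (k c)

/-- `e_k(0) = 1`. [folklore] -/
theorem pw_zero (L : ℝ) (k : Fin 3 → ℤ) : pw L k 0 = 1 := by
  simp [pw, phase_zero]

/-- `x ↦ θ_k(x)` is smooth (it is linear). [folklore] -/
theorem contDiff_phase (L : ℝ) (k : Fin 3 → ℤ) : ContDiff ℝ 1 (phase L k) := by
  unfold phase
  refine contDiff_const.mul ?_
  refine ContDiff.sum fun c _ => ?_
  refine contDiff_const.mul ?_
  exact (EuclideanSpace.proj (𝕜 := ℝ) (ι := Fin 3) c).contDiff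

/-- `e_k` is `C¹`. [folklore] -/
theorem contDiff_pw (L : ℝ) (k : Fin 3 → ℤ) : ContDiff ℝ 1 (pw L k) := by
  unfold pw
  exact ((Complex.ofRealCLM.contDiff.comp (contDiff_phase L k)).mul contDiff_const).cexp

/-- The `N`-body product `∏ⱼ e_k(xⱼ)` is `C¹`. [folklore] -/
theorem contDiff_prod_pw (N : ℕ) (L : ℝ) (k : Fin 3 → ℤ) :
    ContDiff ℝ 1 fun X : Config N => ∏ j, pw L k (X j) := by
  refine contDiff_prod fun j _ => ?_
  exact (contDiff_pw L k).comp (ContinuousLinearMap.proj (R := ℝ) (φ := fun _ : Fin N => Space) j).contDiff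

/-- The normalisation constant `L^{-3N/2}` (as a real number). [folklore] -/
def normConst (N : ℕ) (L : ℝ) : ℝ := ((Real.sqrt (L ^ 3))⁻¹) ^ N

/-- `L^{-3N/2} > 0`. [folklore] -/
theorem normConst_pos {N : ℕ} {L : ℝ} (hL : 0 < L) : 0 < normConst N L := by
  unfold normConst; positivity

/-- **Plane-wave (boosted condensate) trial state** `Ψ(X) = L^{-3N/2} ∏ⱼ exp(2πi k·xⱼ/L)`:
`C¹`, periodic, Bose-symmetric, `|Ψ|² ≡ L^{-3N}` so normalised on the cell. For `k = 0` this is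
the constant state (the free periodic ground state). [folklore] -/
def planeWave (N : ℕ) {L : ℝ} (hL : 0 < L) (k : Fin 3 → ℤ) : PeriodicTrialState N L where
  ψ X := (normConst N L : ℂ) * ∏ j, pw L k (X j)
  contDiff := contDiff_const.mul (contDiff_prod_pw N L k)
  periodic X i c := by
    congr 1
    refine Finset.prod_congr rfl fun j _ => ?_
    rcases eq_or_ne j i with rfl | hji
    · rw [Pi.add_apply, Pi.single_eq_same, pw_add, pw_single L hL.ne' k c, mul_one]
    · rw [Pi.add_apply, Pi.single_eq_of_ne hji, add_zero]
  symm σ X := by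
    congr 1
    exact Equiv.prod_comp σ (fun j => pw L k (X j))
  norm_eq := by
    have hL3 : 0 < L ^ 3 := by positivity
    have hsq : normConst N L ^ 2 = ((L ^ 3)⁻¹) ^ N := by
      rw [normConst, ← pow_mul, mul_comm, pow_mul, inv_pow, Real.sq_sqrt hL3.le]
    have hconst : ∀ X : Config N,
        ((‖(normConst N L : ℂ) * ∏ j, pw L k (X j)‖₊ : ℝ≥0∞) ^ 2) =
          ENNReal.ofReal (((L ^ 3)⁻¹) ^ N) := by
      intro X
      have hn : ‖(normConst N L : ℂ) * ∏ j, pw L k (X j)‖ = normConst N L := by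
        rw [norm_mul, Complex.norm_real, Real.norm_of_nonneg (normConst_pos hL).le,
          norm_prod, Finset.prod_eq_one (fun j _ => norm_pw L k (X j)), mul_one]
      rw [← ofReal_norm_sq_eq, hn, hsq]
    simp_rw [hconst]
    rw [setLIntegral_const, volume_cellN, ← ENNReal.ofReal_pow hL.le,
      ENNReal.ofReal_pow (inv_nonneg.2 hL3.le), ← mul_pow,
      ← ENNReal.ofReal_mul (inv_nonneg.2 hL3.le), inv_mul_cancel₀ hL3.ne', ENNReal.ofReal_one,
      one_pow]

/-- Unfolding lemma for `planeWave`. [folklore] -/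
@[simp] theorem planeWave_ψ (N : ℕ) {L : ℝ} (hL : 0 < L) (k : Fin 3 → ℤ) (X : Config N) :
    (planeWave N hL k).ψ X = (normConst N L : ℂ) * ∏ j, pw L k (X j) := rfl

/-- The one-dimensional zero mode of a non-trivial plane wave vanishes:
`∫₀ᴸ exp(2πi m t/L) dt = 0` for `m ∈ ℤ ∖ {0}`. [folklore] -/
theorem integral_Ico_exp_eq_zero {L : ℝ} (hL : 0 < L) {m : ℤ} (hm : m ≠ 0) :
    ∫ t in Set.Ico 0 L, Complex.exp (((2 * Real.pi / L * ((m : ℝ) * t) : ℝ) : ℂ) * Complex.I) = 0 := by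
  set C : ℂ := ((2 * Real.pi * m / L : ℝ) : ℂ) * Complex.I with hC
  have hC0 : C ≠ 0 := by
    rw [hC]
    refine mul_ne_zero ?_ Complex.I_ne_zero
    rw [Complex.ofReal_ne_zero]
    have : (m : ℝ) ≠ 0 := Int.cast_ne_zero.mpr hm
    positivity
  have hint : ∀ t : ℝ, Complex.exp (((2 * Real.pi / L * ((m : ℝ) * t) : ℝ) : ℂ) * Complex.I) =
      Complex.exp (C * t) := by
    intro t; rw [hC]; congr 1; push_cast; ring
  simp_rw [hint]
  rw [integral_Ico_eq_integral_Ioc, ← intervalIntegral.integral_of_le hL.le,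
    integral_exp_mul_complex hC0]
  have h1 : Complex.exp (C * (L : ℝ)) = 1 := by
    have hL' : (L : ℂ) ≠ 0 := Complex.ofReal_ne_zero.mpr hL.ne'
    have : C * (L : ℝ) = (m : ℤ) * (2 * Real.pi * Complex.I) := by
      rw [hC]; push_cast; field_simp
    rw [this]; exact Complex.exp_int_mul_two_pi_mul_I m
  rw [h1]
  simp

/-- The zero mode of a non-trivial plane wave on the cell vanishes: `∫_{[0,L)³} e_k = 0` for
`k ≠ 0`. [folklore] -/
theorem setIntegral_cell_pw {L : ℝ} (hL : 0 < L) {k : Fin 3 → ℤ} (hk : k ≠ 0) :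
    ∫ x in cell L, pw L k x = 0 := by
  have hpre : (toLp 2 : (Fin 3 → ℝ) → Space) ⁻¹' cell L = Set.univ.pi fun _ => Set.Ico 0 L := by
    ext y; simp [cell]
  have hmp := PiLp.volume_preserving_toLp (Fin 3)
  have hme : MeasurableEmbedding (toLp 2 : (Fin 3 → ℝ) → Space) :=
    (MeasurableEquiv.toLp 2 (Fin 3 → ℝ)).measurableEmbedding
  rw [← hmp.setIntegral_preimage_emb hme, hpre]
  have hprod : ∀ y : Fin 3 → ℝ, pw L k (toLp 2 y) =
      ∏ c, Complex.exp (((2 * Real.pi / L * ((k c : ℝ) * y c) : ℝ) : ℂ) * Complex.I) := by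
    intro y
    simp only [pw, phase]
    rw [Finset.mul_sum, Complex.ofReal_sum, Finset.sum_mul, Complex.exp_sum]
  simp_rw [hprod]
  rw [volume_pi, Measure.restrict_pi_pi,
    integral_fintype_prod_eq_prod
      (fun c (t : ℝ) => Complex.exp (((2 * Real.pi / L * ((k c : ℝ) * t) : ℝ) : ℂ) * Complex.I))]
  obtain ⟨c₀, hc₀⟩ : ∃ c, k c ≠ 0 := by
    by_contra h
    push Not at h
    exact hk (funext h)
  exact Finset.prod_eq_zero (Finset.mem_univ c₀) (integral_Ico_exp_eq_zero hL hc₀)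

/-- **Key identity.** For the `(N+1)`-body plane-wave state with `k ≠ 0`, the tagged-particle
zero-mode integral vanishes identically: `∫_cell Ψ(x, X) dx = 0` for every `X`. Hence its insertion
overlap with `φ₀ ⊗ Θ` is `0` for EVERY `N`-body state `Θ`. [folklore] -/
theorem setIntegral_cell_planeWave_succ (N : ℕ) {L : ℝ} (hL : 0 < L) {k : Fin 3 → ℤ} (hk : k ≠ 0)
    (X : Config N) :
    ∫ x in cell L, (planeWave (N + 1) hL k).ψ (Matrix.vecCons x X) = 0 := by
  have h : ∀ x : Space, (planeWave (N + 1) hL k).ψ (Matrix.vecCons x X) =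
      ((normConst (N + 1) L : ℂ) * ∏ j : Fin N, pw L k (X j)) * pw L k x := by
    intro x
    rw [planeWave_ψ, Fin.prod_univ_succ, Matrix.cons_val_zero]
    simp only [Matrix.cons_val_succ]
    ring
  simp_rw [h]
  rw [integral_const_mul, setIntegral_cell_pw hL hk, mul_zero]

/-- The insertion overlap of the boosted condensate with `φ₀ ⊗ Θ` vanishes for every `Θ`. [folklore] -/
theorem insertionOverlap_planeWave_succ (N : ℕ) {L : ℝ} (hL : 0 < L) {k : Fin 3 → ℤ} (hk : k ≠ 0)
    (Θ : Config N → ℂ) :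
    ∫ X in cellN N L, conj (Θ X) * ∫ x in cell L, (planeWave (N + 1) hL k).ψ (Matrix.vecCons x X)
      = 0 := by
  simp_rw [setIntegral_cell_planeWave_succ N hL hk, mul_zero]
  exact integral_zero _ _

/-- The unit lattice vector `e₀ = (1,0,0) ≠ 0`. [folklore] -/
def e0 : Fin 3 → ℤ := Pi.single 0 1

/-- `e₀ ≠ 0`. [folklore] -/
theorem e0_ne_zero : e0 ≠ 0 := by
  intro h
  have := congrFun h 0
  simp [e0] at this

/-- `sideLength ρ (N+1) > 0` for `ρ > 0`. [folklore] -/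
theorem sideLength_succ_pos {ρ : ℝ} (hρ : 0 < ρ) (N : ℕ) : 0 < sideLength ρ (N + 1) := by
  unfold sideLength
  apply Real.rpow_pos_of_pos
  positivity

/-! ## §3 Load-bearing: the near-minimiser window on `Ψ` -/

/-- `InsertionResidue` with the hypothesis "`Ψ` is a `δ`-near-minimiser" DROPPED (everything else
verbatim). -/
def InsertionResidueWithoutWindow : Prop :=
  ∀ v : ℝ → ENNReal, IsRepulsiveFiniteRange v → ∃ ρ₀ : ℝ, 0 < ρ₀ ∧ ∀ ρ : ℝ, 0 < ρ → ρ < ρ₀ →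
    ∃ c : ℝ, 0 < c ∧ ∀ᶠ N : ℕ in Filter.atTop, ∃ δ : ENNReal, 0 < δ ∧
      ∃ Θ : PeriodicTrialState N (sideLength ρ (N + 1)),
        periodicEnergy v Θ ≤ periodicGroundStateEnergy v N (sideLength ρ (N + 1)) + δ ∧
        ∀ Ψ : PeriodicTrialState (N + 1) (sideLength ρ (N + 1)),
          ENNReal.ofReal c ≤ ENNReal.ofReal ((sideLength ρ (N + 1) ^ 3)⁻¹) *
            (‖∫ X in cellN N (sideLength ρ (N + 1)), conj (Θ.ψ X) *
                ∫ x in cell (sideLength ρ (N + 1)), Ψ.ψ (Matrix.vecCons x X)‖₊ : ENNReal) ^ 2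

/-- The crux with the window dropped from its conclusion. -/
def CorrectorClosureWithoutWindow : Prop :=
  StaticResponseBound → InsertionResidueWithoutWindow

/-- The free gas `v = 0` is an admissible (repulsive, finite-range) potential. [folklore] -/
theorem isRepulsiveFiniteRange_zero : IsRepulsiveFiniteRange (0 : ℝ → ENNReal) :=
  ⟨measurable_const, ⟨0, fun _ _ => rfl⟩⟩

/-- **Load-bearing (window).** Without the near-minimiser hypothesis on `Ψ` the target is false,
for every admissible `v` (here `v = 0`): the boosted condensate has zero insertion overlap with
`φ₀ ⊗ Θ` whatever `Θ` is. Any proof of the crux must use the energy window of `Ψ`. [folklore] -/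
theorem insertionResidue_false_without_window : ¬ InsertionResidueWithoutWindow := by
  intro h
  obtain ⟨ρ₀, hρ₀, h⟩ := h 0 isRepulsiveFiniteRange_zero
  obtain ⟨c, hc, h⟩ := h (ρ₀ / 2) (by positivity) (by linarith)
  obtain ⟨N, δ, _hδ, Θ, _hΘ, h⟩ := h.exists
  have hL := sideLength_succ_pos (show (0 : ℝ) < ρ₀ / 2 by positivity) N
  have h := h (planeWave (N + 1) hL e0)
  rw [insertionOverlap_planeWave_succ N hL e0_ne_zero] at h
  simp only [nnnorm_zero, ENNReal.coe_zero, ne_eq, OfNat.ofNat_ne_zero, not_false_eq_true,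
    zero_pow, mul_zero, nonpos_iff_eq_zero, ENNReal.ofReal_eq_zero] at h
  linarith

/-- Hence the window-less crux holds iff K1 fails: it carries no information beyond `¬ K1`. [folklore] -/
theorem correctorClosureWithoutWindow_iff :
    CorrectorClosureWithoutWindow ↔ ¬ StaticResponseBound :=
  ⟨fun h hS => insertionResidue_false_without_window (h hS), fun h hS => (h hS).elim⟩

/-! ## §4 Load-bearing: finite range (finiteness of the ground-state energy) -/

/-- `InsertionResidue` with `IsRepulsiveFiniteRange v` WEAKENED to `Measurable v` (everything else
verbatim). -/
def InsertionResidueWithoutFiniteRange : Prop :=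
  ∀ v : ℝ → ENNReal, Measurable v → ∃ ρ₀ : ℝ, 0 < ρ₀ ∧ ∀ ρ : ℝ, 0 < ρ → ρ < ρ₀ →
    ∃ c : ℝ, 0 < c ∧ ∀ᶠ N : ℕ in Filter.atTop, ∃ δ : ENNReal, 0 < δ ∧
      ∃ Θ : PeriodicTrialState N (sideLength ρ (N + 1)),
        periodicEnergy v Θ ≤ periodicGroundStateEnergy v N (sideLength ρ (N + 1)) + δ ∧
        ∀ Ψ : PeriodicTrialState (N + 1) (sideLength ρ (N + 1)),
          periodicEnergy v Ψ ≤ periodicGroundStateEnergy v (N + 1) (sideLength ρ (N + 1)) + δ →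
          ENNReal.ofReal c ≤ ENNReal.ofReal ((sideLength ρ (N + 1) ^ 3)⁻¹) *
            (‖∫ X in cellN N (sideLength ρ (N + 1)), conj (Θ.ψ X) *
                ∫ x in cell (sideLength ρ (N + 1)), Ψ.ψ (Matrix.vecCons x X)‖₊ : ENNReal) ^ 2

/-- For the constant potential `v ≡ 1` the periodised potential is `∑_{n ∈ ℤ³} 1 = ⊤`. [folklore] -/
theorem periodizedPotential_one (L : ℝ) (x : Space) :
    periodizedPotential (fun _ => 1) L x = ⊤ := by
  unfold periodizedPotential
  exact ENNReal.tsum_const_eq_top_of_ne_zero one_ne_zero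

/-- Hence every configuration of at least two particles has infinite interaction. [folklore] -/
theorem periodicInteraction_one {N : ℕ} (hN : 2 ≤ N) (L : ℝ) (X : Config N) :
    periodicInteraction (fun _ => 1) L X = ⊤ := by
  unfold periodicInteraction
  have h0 : (⟨0, by omega⟩ : Fin N) ∈ (Finset.univ : Finset (Fin N)) := Finset.mem_univ _
  refine ENNReal.sum_eq_top.2 ⟨⟨0, by omega⟩, h0, ?_⟩
  refine ENNReal.sum_eq_top.2 ⟨⟨1, by omega⟩, ?_, ?_⟩
  · simp [Fin.lt_def]
  · exact periodizedPotential_one L _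

/-- And every periodic trial state of at least two particles has infinite energy. [folklore] -/
theorem periodicEnergy_one_eq_top {N : ℕ} (hN : 2 ≤ N) {L : ℝ} (Ψ : PeriodicTrialState N L) :
    periodicEnergy (fun _ => 1) Ψ = ⊤ := by
  unfold periodicEnergy
  have hmeas : Measurable fun X : Config N => (‖Ψ.ψ X‖₊ : ℝ≥0∞) ^ 2 :=
    (Ψ.contDiff.continuous.measurable.nnnorm.coe_nnreal_ennreal.pow_const 2)
  refine top_le_iff.1 ?_
  calc (⊤ : ℝ≥0∞) = ⊤ * ∫⁻ X in cellN N L, (‖Ψ.ψ X‖₊ : ℝ≥0∞) ^ 2 := by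
        rw [Ψ.norm_eq, mul_one]
    _ = ∫⁻ X in cellN N L, ⊤ * (‖Ψ.ψ X‖₊ : ℝ≥0∞) ^ 2 := (lintegral_const_mul ⊤ hmeas).symm
    _ = ∫⁻ X in cellN N L, periodicInteraction (fun _ => 1) L X * (‖Ψ.ψ X‖₊ : ℝ≥0∞) ^ 2 := by
        simp_rw [periodicInteraction_one hN]
    _ ≤ _ := lintegral_mono fun X => le_add_self

/-- So the ground-state energy is `⊤` and EVERY state is a `δ`-near-minimiser. [folklore] -/
theorem periodicGroundStateEnergy_one_eq_top {N : ℕ} (hN : 2 ≤ N) (L : ℝ) :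
    periodicGroundStateEnergy (fun _ => 1) N L = ⊤ := by
  unfold periodicGroundStateEnergy
  exact iInf_eq_top.2 fun Ψ => periodicEnergy_one_eq_top hN Ψ

/-- **Load-bearing (finite range).** With `Measurable v` only, the target is false: `v ≡ 1`.
Any proof must use `E₀^{per}(N+1, L) < ⊤` for `ρ < ρ₀(v)`, the only place finite range enters the
target. [folklore] -/
theorem insertionResidue_false_without_finiteRange : ¬ InsertionResidueWithoutFiniteRange := by
  intro h
  obtain ⟨ρ₀, hρ₀, h⟩ := h (fun _ => 1) measurable_const
  obtain ⟨c, hc, h⟩ := h (ρ₀ / 2) (by positivity) (by linarith)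
  obtain ⟨N, ⟨δ, _hδ, Θ, _hΘ, h⟩, hN1⟩ := (h.and (Filter.eventually_ge_atTop 1)).exists
  have hL := sideLength_succ_pos (show (0 : ℝ) < ρ₀ / 2 by positivity) N
  have h := h (planeWave (N + 1) hL e0)
    (by rw [periodicGroundStateEnergy_one_eq_top (by omega)]; exact le_top)
  rw [insertionOverlap_planeWave_succ N hL e0_ne_zero] at h
  simp only [nnnorm_zero, ENNReal.coe_zero, ne_eq, OfNat.ofNat_ne_zero, not_false_eq_true,
    zero_pow, mul_zero, nonpos_iff_eq_zero, ENNReal.ofReal_eq_zero] at h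
  linarith

end Summit.AtomisticToContinuum.BoseEinsteinCondensation.Theorems.CorrectorClosure.Negative

end
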